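import Mathlib.AlgebraicGeometry.Morphisms.FlatRank
import Mathlib.AlgebraicGeometry.ResidueField
import Mathlib.RingTheory.Spectrum.Prime.Noetherian
import Mathlib.RingTheory.Artinian.Ring
import Mathlib.RingTheory.LocalRing.Module
import Mathlib.LinearAlgebra.TensorProduct.Pi
import HarnessLib

/-!
# The rank of a composite of finite flat morphisms; the rank of a fibre product; constancy over a local base

Topic `Literature/AlgebraicGeometry/Morphisms`; namespace `Literature.AlgebraicGeometry.Morphisms`.  THEOREMS ONLY (no definition, no
named fact, no instance, no notation, no `sorry`).  Cell `hodgecm-mathlib` (D-0151), FLOOR 0, P6 «MOD programme», the rank engine of the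
P6b line's `stub_L42_idempotentSplitting` (the HEIGHT of the Barsotti–Tate group split off by an idempotent: rank of `Fix ε_n` is
multiplicative along `0 → Fix ε_1 → Fix ε_{n+1} → Fix ε_n → 0` and divides `p^{nh}` through `G_n ≅ Fix ε_n × Ker ε_n`);
`--supports stmt-HodgeConjecture-24832`; COUNT-NEUTRAL: HC_CM is proved only modulo the 7 printed citations until rung 0 closes; this file
discharges none of them.

THE PRINT.  For a finite morphism `g : Y → S` and a finite locally free `𝒪_Y`-module `𝓕` of rank `d`, `g_* 𝓕` is a finite locally
free `g_* 𝒪_Y`-module of rank `d` ([GortzWedhorn2020] Prop. 12.13); hence for `f : X → Y` finite locally free of degree `d` on the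
fibre of `g` over `s` and `g` finite locally free, the degree (12.6.1) of `f ≫ g` at `s` is `d · deg_s g` ([StacksProject] Tag 02K9).
Mathlib's currency is the POINTWISE rank `Scheme.Hom.finrank` of a finite flat morphism ([StacksProject] Tag 02KA; on `Spec` it is
`Module.rankAtStalk`), for which Mathlib has base change (`finrank_pullback_snd`) but neither composites nor products; the ring core is
the Artinian decomposition `S̄ ≅ ∏_𝔮 S̄_𝔮` ([StacksProject] Tag 00JA, Mathlib `PrimeSpectrum.toPiLocalizationEquiv`) and «finite flat
over a local ring is free» ([StacksProject] Tag 00NZ, Mathlib `Module.free_of_flat_of_isLocalRing`).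

WHAT IS HERE:
* §1 (algebra) **`finrank_eq_mul_finrank_of_rankAtStalk_eq`** — `κ` a field, `S` a finite `κ`-algebra, `M` a finite flat `S`-module of
  constant rank `d` (`rankAtStalk M ≡ d`) ⇒ `dim_κ M = d · dim_κ S`; `ringHom_finrank_comp_of_field` (the same for `κ → S → T`,
  `RingHom.finrank`);
* §2 (affine) `finrank_eq_finrank_appTop` — `f.finrank y` of a finite flat morphism of affine schemes is the ring rank of `Γ(f)` at the
  prime of `y`; `finrank_comp_eq_mul_of_field` — the composite formula over `Spec κ`;
* §3 **`finrank_comp_eq_mul`** — `f : X → Y`, `g : Y → S` finite flat, `f.finrank y = d` for every `y` over `s` ⇒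
  `(f ≫ g).finrank s = d · g.finrank s` (base change to `Spec κ(s)`, then §2);
* §4 **`finrank_tensorObj_hom`** — in `Over S`: `rk_s (X ⊗ Y) = rk_s Y · rk_s X` for `X → S`, `Y → S` finite flat;
* §5 **`finrank_eq_finrank_of_isLocalRing`** — over `Spec A`, `A` LOCAL, the rank of a finite flat `X → Spec A` is the same at all points
  (Mathlib `Module.rankAtStalk_eq_of_le_of_finite_of_flat`: every prime specialises to the closed point).

## References
* [GortzWedhorn2020] U. Görtz, T. Wedhorn, *Algebraic Geometry I: Schemes*, 2nd ed. (2020) — Proposition 12.13; Section (12.6),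
  Proposition 12.19 and the degree (12.6.1).
* [StacksProject] The Stacks Project — Tag 02K9 (finite locally free morphisms), Tag 02KA (degree), Tag 00JA (Artinian rings are products
  of their localizations), Tag 00NZ (finite flat modules over a local ring are free).
-/

noncomputable section

universe u

open CategoryTheory CategoryTheory.Limits Module

namespace Literature.AlgebraicGeometry.Morphisms

/-! ## §1 Algebra: over a finite algebra over a field, a finite flat module of constant rank `d` has `κ`-dimension `d · dim_κ S` -/

section Algebra

open TensorProduct

/-- **Constant rank `d` over a finite `κ`-algebra multiplies `κ`-dimensions by `d`.**  `κ` a field, `S` a finite (hence Artinian)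
`κ`-algebra, `M` a finite flat `S`-module with `rankAtStalk M 𝔮 = d` at every prime `𝔮` of `S`; then `dim_κ M = d · dim_κ S`.  Proof:
`S ≅ ∏_𝔮 S_𝔮` (Artinian), so `M ≅ ∏_𝔮 S_𝔮 ⊗_S M`; each `S_𝔮 ⊗_S M` is finite flat over the local ring `S_𝔮`, hence free, of rank
`rankAtStalk M 𝔮 = d`, so of `κ`-dimension `d · dim_κ S_𝔮`; sum over `𝔮`. [cite: StacksProject, Tag 00JA] [cite: StacksProject, Tag 00NZ]
[cite: GortzWedhorn2020, Proposition 12.13] -/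
theorem finrank_eq_mul_finrank_of_rankAtStalk_eq (κ : Type*) [Field κ] (S : Type*) [CommRing S] [Algebra κ S]
    [Module.Finite κ S] (M : Type*) [AddCommGroup M] [Module S M] [Module κ M] [IsScalarTower κ S M]
    [Module.Finite S M] [Module.Flat S M] (d : ℕ) (hd : ∀ q : PrimeSpectrum S, Module.rankAtStalk M q = d) :
    Module.finrank κ M = d * Module.finrank κ S := by
  classical
  haveI : IsArtinianRing S := IsArtinianRing.of_finite κ S
  haveI : Fintype (PrimeSpectrum S) := Fintype.ofFinite _
  let L : PrimeSpectrum S → Type _ := fun q => Localization.AtPrime q.asIdeal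
  let e : S ≃ₐ[S] PrimeSpectrum.PiLocalization S := PrimeSpectrum.toPiLocalizationEquiv S
  -- `M ≅ ∏_𝔮 S_𝔮 ⊗_S M`, `S`-linearly
  let eM : M ≃ₗ[S] Π q : PrimeSpectrum S, L q ⊗[S] M :=
    (TensorProduct.lid S M).symm ≪≫ₗ TensorProduct.congr e.toLinearEquiv (LinearEquiv.refl S M) ≪≫ₗ
      TensorProduct.piLeft (R := S) (M := fun q : PrimeSpectrum S => L q) (N := M)
  -- each `S_𝔮` is a finite `κ`-algebra (a quotient of `S`)
  have hLfin : ∀ q : PrimeSpectrum S, Module.Finite κ (L q) := fun q => by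
    haveI : Module.Finite S (L q) :=
      Module.Finite.of_surjective (Algebra.linearMap S (L q))
        (IsArtinianRing.localization_surjective q.asIdeal.primeCompl (L q))
    exact Module.Finite.trans S (L q)
  -- each `S_𝔮 ⊗_S M` is free of rank `d` over the local ring `S_𝔮`
  have hfree : ∀ q : PrimeSpectrum S, Module.finrank κ (L q ⊗[S] M) = d * Module.finrank κ (L q) := fun q => by
    haveI : Module.Free (L q) (L q ⊗[S] M) := Module.free_of_flat_of_isLocalRing
    have hrk : Module.finrank (L q) (L q ⊗[S] M) = d := by
      rw [← Module.rankAtStalk_eq_finrank_tensorProduct, hd q]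
    haveI := hLfin q
    let b : (L q ⊗[S] M) ≃ₗ[L q] (Fin d → L q) := (Module.finBasis (L q) (L q ⊗[S] M)).equivFun ≪≫ₗ
      LinearEquiv.funCongrLeft (L q) (L q) (finCongr hrk.symm)
    rw [(b.restrictScalars κ).finrank_eq, Module.finrank_pi_fintype, Finset.sum_const, Finset.card_univ,
      Fintype.card_fin, smul_eq_mul]
  haveI : ∀ q : PrimeSpectrum S, Module.Finite κ (L q ⊗[S] M) := fun q => by
    haveI := hLfin q
    exact Module.Finite.trans (L q) _
  rw [(eM.restrictScalars κ).finrank_eq, Module.finrank_pi_fintype, Finset.sum_congr rfl fun q _ => hfree q,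
    ← Finset.mul_sum, ← Module.finrank_pi_fintype, ← (e.toLinearEquiv.restrictScalars κ).finrank_eq]

/-- **Ranks multiply along a tower over a field**: for ring maps `ψ : κ → S` finite (`κ` a field) and `φ : S → T` finite flat of
constant rank `d` (`φ.finrank ≡ d`), `(φ ∘ ψ).finrank = d · ψ.finrank` (Mathlib `RingHom.finrank` = `rankAtStalk` of the induced
algebra; over a field it is the `κ`-dimension). [cite: GortzWedhorn2020, Proposition 12.13] [cite: StacksProject, Tag 02K9] -/
theorem ringHom_finrank_comp_of_field (κ : Type*) [Field κ] {S T : Type*} [CommRing S] [CommRing T]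
    (ψ : κ →+* S) (φ : S →+* T) (hψ : ψ.Finite) (hφ₁ : φ.Finite) (hφ₂ : φ.Flat) (d : ℕ)
    (hd : ∀ q, φ.finrank q = d) (p : PrimeSpectrum κ) : (φ.comp ψ).finrank p = d * ψ.finrank p := by
  algebraize [ψ, φ, φ.comp ψ]
  change Module.rankAtStalk (R := κ) T p = d * Module.rankAtStalk (R := κ) S p
  have hd' : ∀ q : PrimeSpectrum S, Module.rankAtStalk (R := S) T q = d := hd
  haveI : Module.Finite κ T := Module.Finite.trans S T
  rw [Module.rankAtStalk_eq_finrank_of_free, Module.rankAtStalk_eq_finrank_of_free]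
  exact finrank_eq_mul_finrank_of_rankAtStalk_eq κ S T d hd'

end Algebra

open _root_.AlgebraicGeometry MonoidalCategory

/-! ## §2 Affine schemes: `finrank` is the ring rank of `Γ(f)`; the composite formula over a field -/

/-- For a finite flat morphism `f : X → Y` of AFFINE schemes, Mathlib's pointwise rank `f.finrank y` is the rank
`RingHom.finrank Γ(f)` at the prime of `Γ(Y, ⊤)` corresponding to `y` (the square `X ≅ Spec Γ(X) → Spec Γ(Y) ≅ Y` is cartesian;
Mathlib `finrank_of_isPullback`, `finrank_SpecMap_eq_finrank`). [cite: StacksProject, Tag 02KA] [cite: GortzWedhorn2020, Section (12.6), (12.6.1)] -/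
theorem finrank_eq_finrank_appTop {X Y : Scheme.{u}} [IsAffine X] [IsAffine Y] (f : X ⟶ Y) [IsFinite f] [Flat f]
    (y : Y) : f.finrank y = f.appTop.hom.finrank (Y.isoSpec.hom y) := by
  haveI : IsFinite (Spec.map f.appTop) := (IsFinite.SpecMap_iff _).mpr f.finite_appTop
  haveI : Flat (Spec.map f.appTop) := Flat.SpecMap_iff.mpr f.flat_appTop
  have hsq : IsPullback X.isoSpec.hom f (Spec.map f.appTop) Y.isoSpec.hom :=
    IsPullback.of_horiz_isIso ⟨(Scheme.isoSpec_hom_naturality f)⟩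
  rw [Scheme.Hom.finrank_of_isPullback _ _ _ _ hsq, Scheme.Hom.finrank_SpecMap_eq_finrank f.finite_appTop f.flat_appTop]

/-- **The composite formula over a field.**  `f : X → Y`, `g : Y → Spec κ` finite flat (`κ` a field), `f.finrank ≡ d` ⇒
`(f ≫ g).finrank = d · g.finrank` at the point of `Spec κ` (`X`, `Y` are affine; transport `Γ(Spec κ, ⊤) ≅ κ` by Mathlib
`RingHom.finrank_comp_right_of_bijective`; then §1). [cite: GortzWedhorn2020, Proposition 12.13] [cite: StacksProject, Tag 02K9] -/
theorem finrank_comp_eq_mul_of_field (κ : Type u) [Field κ] {X Y : Scheme.{u}} (f : X ⟶ Y) (g : Y ⟶ Spec (.of κ))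
    [IsFinite f] [Flat f] [IsFinite g] [Flat g] (d : ℕ) (hd : ∀ y, f.finrank y = d) (pt : Spec (.of κ)) :
    (f ≫ g).finrank pt = d * g.finrank pt := by
  haveI : IsAffine Y := isAffine_of_isAffineHom g
  haveI : IsAffine X := isAffine_of_isAffineHom f
  rw [finrank_eq_finrank_appTop g pt, finrank_eq_finrank_appTop (f ≫ g) pt, Scheme.Hom.comp_appTop,
    CommRingCat.hom_comp]
  have hd' : ∀ q, f.appTop.hom.finrank q = d := fun q => by
    have := hd (Y.isoSpec.inv q)
    rwa [finrank_eq_finrank_appTop f, ← Scheme.Hom.comp_apply, Iso.inv_hom_id] at this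
  -- transport the base `Γ(Spec κ, ⊤)` to the field `κ`
  let ι₀ : κ →+* Γ(Spec (.of κ), ⊤) := (Scheme.ΓSpecIso (.of κ)).inv.hom
  have hι₀ : Function.Bijective ι₀ := ConcreteCategory.bijective_of_isIso (Scheme.ΓSpecIso (.of κ)).inv
  have h1 := RingHom.finrank_comp_right_of_bijective ι₀ g.appTop.hom hι₀ g.finite_appTop g.flat_appTop
      (PrimeSpectrum.comap ι₀ ((Spec (CommRingCat.of κ)).isoSpec.hom pt)) ((Spec (CommRingCat.of κ)).isoSpec.hom pt) rfl
  have hfin : (f.appTop.hom.comp g.appTop.hom).Finite := f.finite_appTop.comp g.finite_appTop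
  have hflat : (f.appTop.hom.comp g.appTop.hom).Flat := g.flat_appTop.comp f.flat_appTop
  have h2 := RingHom.finrank_comp_right_of_bijective ι₀ (f.appTop.hom.comp g.appTop.hom) hι₀ hfin hflat
      (PrimeSpectrum.comap ι₀ ((Spec (CommRingCat.of κ)).isoSpec.hom pt)) ((Spec (CommRingCat.of κ)).isoSpec.hom pt) rfl
  rw [← h1, ← h2, RingHom.comp_assoc]
  exact ringHom_finrank_comp_of_field κ (g.appTop.hom.comp ι₀) f.appTop.hom
    (g.finite_appTop.comp (RingHom.Finite.of_surjective ι₀ hι₀.2)) f.finite_appTop f.flat_appTop d hd' _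

/-! ## §3 The rank of a composite of finite flat morphisms -/

/-- **THE RANK OF A COMPOSITE OF FINITE FLAT MORPHISMS.**  Let `f : X → Y` and `g : Y → S` be finite flat and suppose `f` has rank
`d` at every point of the fibre `g⁻¹(s)`.  Then `(f ≫ g).finrank s = d · g.finrank s` — `f_* 𝒪_X` is locally free of rank `d` over
`𝒪_Y` near the fibre and `g_*` of a rank-`d` locally free `𝒪_Y`-module is a rank-`d` locally free `g_* 𝒪_Y`-module.  Proof: base change
along `Spec κ(s) → S` (Mathlib `finrank_pullback_snd`, `pullbackRightPullbackFstIso`), then `finrank_comp_eq_mul_of_field`.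
[cite: GortzWedhorn2020, Proposition 12.13] [cite: StacksProject, Tag 02K9] -/
theorem finrank_comp_eq_mul {X Y S : Scheme.{u}} (f : X ⟶ Y) (g : Y ⟶ S) [IsFinite f] [Flat f] [IsFinite g] [Flat g]
    (s : S) (d : ℕ) (hd : ∀ y : Y, g y = s → f.finrank y = d) :
    (f ≫ g).finrank s = d * g.finrank s := by
  let ι := S.fromSpecResidueField s
  let pt : Spec (S.residueField s) := IsLocalRing.closedPoint (S.residueField s)
  have hι : ι pt = s := Scheme.fromSpecResidueField_apply s pt
  rw [← hι, ← Scheme.Hom.finrank_pullback_snd g ι pt, ← Scheme.Hom.finrank_pullback_snd (f ≫ g) ι pt,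
    ← Scheme.Hom.finrank_comp_left_of_isIso (pullbackRightPullbackFstIso g ι f).hom (pullback.snd (f ≫ g) ι),
    pullbackRightPullbackFstIso_hom_snd]
  refine finrank_comp_eq_mul_of_field (S.residueField s) (pullback.snd f (pullback.fst g ι)) (pullback.snd g ι) d
    (fun y => ?_) pt
  rw [Scheme.Hom.finrank_pullback_snd]
  apply hd
  rw [← Scheme.Hom.comp_apply, pullback.condition, Scheme.Hom.comp_apply]
  exact Scheme.fromSpecResidueField_apply s _

/-! ## §4 The rank of a fibre product -/

/-- **THE RANK OF A FIBRE PRODUCT** (cartesian product `X ⊗ Y` of Mathlib's cartesian-monoidal `Over S`, i.e. `X ×_S Y → S` through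
`X`): for `X → S`, `Y → S` finite flat, `rk_s (X ⊗ Y) = rk_s Y · rk_s X` (the first projection `X ×_S Y → X` has rank `rk_s Y` on the
fibre over `s` by base change; then §3). [cite: GortzWedhorn2020, Proposition 12.13] [cite: StacksProject, Tag 02K9] -/
theorem finrank_tensorObj_hom {S : Scheme.{u}} (X Y : Over S) [IsFinite X.hom] [Flat X.hom] [IsFinite Y.hom] [Flat Y.hom]
    (s : S) : (X ⊗ Y).hom.finrank s = Y.hom.finrank s * X.hom.finrank s := by
  rw [Over.tensorObj_hom]
  refine finrank_comp_eq_mul (pullback.fst X.hom Y.hom) X.hom s (Y.hom.finrank s) fun x hx => ?_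
  rw [Scheme.Hom.finrank_pullback_fst, hx]

/-! ## §5 Over a local base the rank is constant -/

/-- **Over the spectrum of a LOCAL ring the rank of a finite flat morphism is the same at all points**: `Γ(X)` is a finite flat,
hence free, module over the local ring `A ≅ Γ(Spec A, ⊤)`, and `rankAtStalk` is constant along specialisations (Mathlib
`Module.rankAtStalk_eq_of_le_of_finite_of_flat`); every prime specialises to the closed point. [cite: StacksProject, Tag 00NZ]
[cite: StacksProject, Tag 02KA] -/
theorem finrank_eq_finrank_of_isLocalRing {A : Type u} [CommRing A] [IsLocalRing A] {X : Scheme.{u}} (f : X ⟶ Spec (.of A))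
    [IsFinite f] [Flat f] (s s' : Spec (.of A)) : f.finrank s = f.finrank s' := by
  haveI : IsAffine X := isAffine_of_isAffineHom f
  rw [finrank_eq_finrank_appTop f s, finrank_eq_finrank_appTop f s']
  -- `Γ(Spec A, ⊤) ≅ A` is local
  haveI : Nontrivial Γ(Spec (CommRingCat.of A), ⊤) :=
    (Scheme.ΓSpecIso (.of A)).commRingCatIsoToRingEquiv.toEquiv.nontrivial
  haveI : IsLocalRing Γ(Spec (CommRingCat.of A), ⊤) :=
    IsLocalRing.of_surjective' (Scheme.ΓSpecIso (.of A)).inv.hom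
      (ConcreteCategory.bijective_of_isIso (Scheme.ΓSpecIso (.of A)).inv).2
  algebraize [f.appTop.hom]
  have hf : Module.Finite Γ(Spec (CommRingCat.of A), ⊤) Γ(X, ⊤) := f.finite_appTop
  have hfl : Module.Flat Γ(Spec (CommRingCat.of A), ⊤) Γ(X, ⊤) := f.flat_appTop
  change Module.rankAtStalk (R := Γ(Spec (CommRingCat.of A), ⊤)) Γ(X, ⊤) _ =
    Module.rankAtStalk (R := Γ(Spec (CommRingCat.of A), ⊤)) Γ(X, ⊤) _
  have key : ∀ q : PrimeSpectrum Γ(Spec (CommRingCat.of A), ⊤),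
      Module.rankAtStalk (R := Γ(Spec (CommRingCat.of A), ⊤)) Γ(X, ⊤) q =
        Module.rankAtStalk (R := Γ(Spec (CommRingCat.of A), ⊤)) Γ(X, ⊤) (IsLocalRing.closedPoint _) := fun q =>
    Module.rankAtStalk_eq_of_le_of_finite_of_flat _ (IsLocalRing.le_maximalIdeal q.isPrime.ne_top)
  rw [key ((Spec (CommRingCat.of A)).isoSpec.hom s), key ((Spec (CommRingCat.of A)).isoSpec.hom s')]

end Literature.AlgebraicGeometry.Morphisms

end
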